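import Literature.NumberTheory.GelbartRogawski1991.LocalKudlaSplittingInjectiveSplit
import Literature.RepresentationTheory.MoeglinVignerasWaldspurger1987.RankOneThetaLiftLinesEquivalent
import Summits.HodgeConjecture.CorCM.B01.Transposition.Item6OmegaChiSplitting
import Summits.HodgeConjecture.HodgeCM.CM.Basic
import Summits.HodgeConjecture.HodgeCM.Model.ArchSideTerm
import Literature.NumberTheory.Automorphic.IdeleClassCharacterHecke
import Literature.RepresentationTheory.Liu2021.OscillatorConventions
import Literature.NumberTheory.GelbartRogawski1991.CMSplittingCharLocalMu
import HarnessLib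

/-!
# `hD3` line `a4-liuD3`: Kudla's local injectivity in TRANSPORTED form (`hK`) from the line-rigidity identity S6a — PLACE-FREE and
# SPLIT-place forms (cell `hodgecm-mathlib`, binder `HypD3`; crux item stmt-HodgeConjecture-24837)

Summits side, binder subdirectory `CorCM/HypD3/`.  Companion of `A4LiuD3KudlaNonsplitOfLineRigidity.lean` (non-split places): the same
five-step reduction «S6a for member `i` ⇒ `hK i j`» with B-p14's PLACE-FREE local injectivity
`GRConstruction.localMu_eq_of_congrW_undoubledSplittings_s_eq_three` (`LocalKudlaSplittingInjectiveSplit.lean`: n = 3, any finite place),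
hence with NO `IsField` binder (`kudla_of_lineRigidity`), and its split-place specialisation `kudla_split_of_lineRigidity` in the binder
shape of the v3 residual stub `stub_kudlaTransportedSectionEq_split : KudlaTransportedSectionEqSplit` (owner B-p18): with the split
S6a identity (B-p13 F8 / B-p02 F8a, using the split `hκ` `eq_one_of_forall_isSiegelDelta_eq_one_of_split` of
`LocalKudlaSplittingRigiditySplit.lean`) as `hS6a`, that stub closes by
`fun F dV hdV hdV0 ψ hψ aOf v hE i j => kudla_split_of_lineRigidity F dV hdV hdV0 ψ hψ aOf v hE i j (S6a_split …)`.

HC_CM is proved only modulo the 7 printed citations (`hDel`, `h21`, `hLiu418`, `h411`, `h413`, `hD3`, `hD1''`) until rung 0 closes; this file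
discharges no binder and no interface fact.

## References
* [Kudla1994] S. Kudla, Israel J. Math. 87 (1994), §3 Thm. 3.1 (explicit splittings).
* [Liu2021] Y. Liu, Camb. J. Math. 9 (2021) = arXiv:2102.11518, App. D Lemma D.1 (3) (l. 5233), proof l. 5249–5255.
* [MoeglinVignerasWaldspurger1987] MVW, LNM 1291, Chap. 2 II.1, Chap. 3 IV.4.
-/


set_option autoImplicit false

noncomputable section

namespace Summit.HodgeConjecture.CorCM.HypD3
open scoped TensorProduct Matrix
open NumberField NumberField.InfinitePlace
open Literature.NumberTheory.ComplexMultiplication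
open Literature.NumberTheory.Automorphic
open Literature.NumberTheory.Automorphic.IdeleClassGroup (toHeckeCharacter isUnitary_toHeckeCharacter)
open Literature.NumberTheory.Automorphic.Liu2021
open HodgeCM.Model.ArchSideTerm (e₁)
open Literature.NumberTheory.GelbartRogawski1991 Literature.NumberTheory.GelbartRogawski1991.UnitaryDualPair
open Literature.NumberTheory.GelbartRogawski1991.UnitaryDualPair.LocalSplitting (localMu norm_localMu continuous_localMu
  localMu_toLocalRing_eq_one_iff lineTransportSection conj_lineDelta lineDelta_ne_zero lineDelta_mul_self)
open Literature.RepresentationTheory Literature.RepresentationTheory.Liu2021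
open Literature.RepresentationTheory.MoeglinVignerasWaldspurger1987 (lineTransportSplitting)
open Summit.HodgeConjecture.CorCM.Transposition

open Literature.NumberTheory.GelbartRogawski1991.GRConstruction (localMu_eq_of_congrW_undoubledSplittings_s_eq_three)
open Literature.NumberTheory.GelbartRogawski1991.UnitaryDualPair.LocalSplitting (lineTransportSection_injective)

-- heartbeats: elaborating the spelled `hK`/`hS6a` binders alone exceeds the default budget (whnf/isDefEq on the packaged CM
-- sections), as in `A4LiuD3SplitInjectiveOfFacts.lean` / `A4LiuD3MuOfIsoNonsplitOfFacts.lean`; the proof is five short steps.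
set_option maxHeartbeats 1600000 in
/-- **Kudla's local injectivity in transported form (`hK i j` of stubs :190/:195) at EVERY finite place, from the line-rigidity
identity S6a for member `i`'s character** (hypothesis `hS6a`): for every CM field `F`, real frame `dV`, index maps `ψ, hψ, aOf`, finite
place `v` of `F⁺` (split OR not) and members `i, j`,
`(∀ x hx, lineTransportSplitting x (s_i) = s^{μ_i}_{a_j}) → ((∃ x hx, lineTransportSplitting x (s_i) = s_j) → localMu μ_j v = localMu μ_i v)`:
equal sections of ONE pair model (`lineTransportSection_injective`) have equal `μ_v` — B-p14's place-free
`localMu_eq_of_congrW_undoubledSplittings_s_eq_three` (n = 3; non-split `…_s_eq`, split `…_s_eq_split`).  The non-split file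
`A4LiuD3KudlaNonsplitOfLineRigidity.lean` is the `IsField` case; this is its place-free form (no `IsField` binder).
[cite: Kudla1994, §3 Thm. 3.1] [cite: Liu2021, App. D Lemma D.1 (3) (l. 5233), proof l. 5249–5255]
[cite: MoeglinVignerasWaldspurger1987, Chap. 2 II.1, Chap. 3 IV.4] -/
theorem kudla_of_lineRigidity :
    ∀ (F : HodgeCM.CMField) (dV : Fin 3 → (F : Type))
      (hdV : ∀ i, IsCMField.complexConj (F : Type) (dV i) = dV i) (hdV0 : ∀ i, dV i ≠ 0) {ι : Type}
      (ψ : ι → (Literature.NumberTheory.Automorphic.IdeleClassGroup (F : Type) →ₜ* Circle))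
      (hψ : ∀ t, IdeleClassGroup.IsConjugateSymplectic (F : Type) (ψ t))
      (aOf : ι → (↥(maximalRealSubfield (F : Type)))ˣ)
      (v : IsDedekindDomain.HeightOneSpectrum (𝓞 ↥(maximalRealSubfield (F : Type)))),
      ∀ i j : ι,
        (∀ (x : (UnitaryGroup.LocalRing (F : Type) v)ˣ) (hx : algebraMap (F : Type) (UnitaryGroup.LocalRing (F : Type) v) (algebraMap ↥(maximalRealSubfield (F : Type)) (F : Type) (↑(aOf j)⁻¹ : ↥(maximalRealSubfield (F : Type))) * imagUnit (F : Type)) =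
            (x : (UnitaryGroup.LocalRing (F : Type) v)) * UnitaryGroup.conjLocal (F : Type) (IsCMField.complexConj (F : Type)) v x * algebraMap (F : Type) (UnitaryGroup.LocalRing (F : Type) v) (algebraMap ↥(maximalRealSubfield (F : Type)) (F : Type) (↑(aOf i)⁻¹ : ↥(maximalRealSubfield (F : Type))) * imagUnit (F : Type))),
          lineTransportSplitting (F : Type) v (IsCMField.complexConj (F : Type)) 3 (conj_lineDelta (complexConj_imagUnit (F : Type)) (aOf i)) (lineDelta_ne_zero (imagUnit_ne_zero (F : Type)) (aOf i))
            (lineDelta_mul_self (imagUnit_mul_self (F : Type)) (aOf i)) (conj_lineDelta (complexConj_imagUnit (F : Type)) (aOf j)) (lineDelta_ne_zero (imagUnit_ne_zero (F : Type)) (aOf j))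
            (lineDelta_mul_self (imagUnit_mul_self (F : Type)) (aOf j)) x (realDiagonal (F : Type) dV hdV) (realDiagonal_isSymm (F : Type) dV hdV) (isUnit_det_realDiagonal (F : Type) dV hdV hdV0) hx
            (lineTransportSection ↥(maximalRealSubfield (F : Type)) (F : Type) (IsCMField.complexConj (F : Type)) 3 (complexConj_imagUnit (F : Type)) (imagUnit_ne_zero (F : Type)) (imagUnit_mul_self (F : Type)) (realDiagonal (F : Type) dV hdV) (realDiagonal_isSymm (F : Type) dV hdV) (Matrix.diagonal dV) (realDiagonal_map (F : Type) dV hdV).symm (aOf i) v ((OmegaChiSplitting.chiLocalSplittingsD ⟨HodgeCM.CMField.K F⟩ e₁ dV hdV hdV0 (toHeckeCharacter (F : Type) (ψ i)) ((isOscillatorChar_toHeckeCharacter_iff (ψ i)).mpr (hψ i)) (aOf i)).s v) ((OmegaChiSplitting.chiLocalSplittingsD ⟨HodgeCM.CMField.K F⟩ e₁ dV hdV hdV0 (toHeckeCharacter (F : Type) (ψ i)) ((isOscillatorChar_toHeckeCharacter_iff (ψ i)).mpr (hψ i)) (aOf i)).proj_s v)) =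
          (lineTransportSection ↥(maximalRealSubfield (F : Type)) (F : Type) (IsCMField.complexConj (F : Type)) 3 (complexConj_imagUnit (F : Type)) (imagUnit_ne_zero (F : Type)) (imagUnit_mul_self (F : Type)) (realDiagonal (F : Type) dV hdV) (realDiagonal_isSymm (F : Type) dV hdV) (Matrix.diagonal dV) (realDiagonal_map (F : Type) dV hdV).symm (aOf j) v ((OmegaChiSplitting.chiLocalSplittingsD ⟨HodgeCM.CMField.K F⟩ e₁ dV hdV hdV0 (toHeckeCharacter (F : Type) (ψ i)) ((isOscillatorChar_toHeckeCharacter_iff (ψ i)).mpr (hψ i)) (aOf j)).s v) ((OmegaChiSplitting.chiLocalSplittingsD ⟨HodgeCM.CMField.K F⟩ e₁ dV hdV hdV0 (toHeckeCharacter (F : Type) (ψ i)) ((isOscillatorChar_toHeckeCharacter_iff (ψ i)).mpr (hψ i)) (aOf j)).proj_s v))) →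
        (∃ (x : (UnitaryGroup.LocalRing (F : Type) v)ˣ) (hx : algebraMap (F : Type) (UnitaryGroup.LocalRing (F : Type) v) (algebraMap ↥(maximalRealSubfield (F : Type)) (F : Type) (↑(aOf j)⁻¹ : ↥(maximalRealSubfield (F : Type))) * imagUnit (F : Type)) =
            (x : (UnitaryGroup.LocalRing (F : Type) v)) * UnitaryGroup.conjLocal (F : Type) (IsCMField.complexConj (F : Type)) v x * algebraMap (F : Type) (UnitaryGroup.LocalRing (F : Type) v) (algebraMap ↥(maximalRealSubfield (F : Type)) (F : Type) (↑(aOf i)⁻¹ : ↥(maximalRealSubfield (F : Type))) * imagUnit (F : Type))),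
          lineTransportSplitting (F : Type) v (IsCMField.complexConj (F : Type)) 3 (conj_lineDelta (complexConj_imagUnit (F : Type)) (aOf i)) (lineDelta_ne_zero (imagUnit_ne_zero (F : Type)) (aOf i))
            (lineDelta_mul_self (imagUnit_mul_self (F : Type)) (aOf i)) (conj_lineDelta (complexConj_imagUnit (F : Type)) (aOf j)) (lineDelta_ne_zero (imagUnit_ne_zero (F : Type)) (aOf j))
            (lineDelta_mul_self (imagUnit_mul_self (F : Type)) (aOf j)) x (realDiagonal (F : Type) dV hdV) (realDiagonal_isSymm (F : Type) dV hdV) (isUnit_det_realDiagonal (F : Type) dV hdV hdV0) hx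
            (lineTransportSection ↥(maximalRealSubfield (F : Type)) (F : Type) (IsCMField.complexConj (F : Type)) 3 (complexConj_imagUnit (F : Type)) (imagUnit_ne_zero (F : Type)) (imagUnit_mul_self (F : Type)) (realDiagonal (F : Type) dV hdV) (realDiagonal_isSymm (F : Type) dV hdV) (Matrix.diagonal dV) (realDiagonal_map (F : Type) dV hdV).symm (aOf i) v ((OmegaChiSplitting.chiLocalSplittingsD ⟨HodgeCM.CMField.K F⟩ e₁ dV hdV hdV0 (toHeckeCharacter (F : Type) (ψ i)) ((isOscillatorChar_toHeckeCharacter_iff (ψ i)).mpr (hψ i)) (aOf i)).s v) ((OmegaChiSplitting.chiLocalSplittingsD ⟨HodgeCM.CMField.K F⟩ e₁ dV hdV hdV0 (toHeckeCharacter (F : Type) (ψ i)) ((isOscillatorChar_toHeckeCharacter_iff (ψ i)).mpr (hψ i)) (aOf i)).proj_s v)) =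
          (lineTransportSection ↥(maximalRealSubfield (F : Type)) (F : Type) (IsCMField.complexConj (F : Type)) 3 (complexConj_imagUnit (F : Type)) (imagUnit_ne_zero (F : Type)) (imagUnit_mul_self (F : Type)) (realDiagonal (F : Type) dV hdV) (realDiagonal_isSymm (F : Type) dV hdV) (Matrix.diagonal dV) (realDiagonal_map (F : Type) dV hdV).symm (aOf j) v ((OmegaChiSplitting.chiLocalSplittingsD ⟨HodgeCM.CMField.K F⟩ e₁ dV hdV hdV0 (toHeckeCharacter (F : Type) (ψ j)) ((isOscillatorChar_toHeckeCharacter_iff (ψ j)).mpr (hψ j)) (aOf j)).s v) ((OmegaChiSplitting.chiLocalSplittingsD ⟨HodgeCM.CMField.K F⟩ e₁ dV hdV hdV0 (toHeckeCharacter (F : Type) (ψ j)) ((isOscillatorChar_toHeckeCharacter_iff (ψ j)).mpr (hψ j)) (aOf j)).proj_s v))) →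
        localMu (F : Type) (toHeckeCharacter (F : Type) (ψ j)) v = localMu (F : Type) (toHeckeCharacter (F : Type) (ψ i)) v := by
  intro F dV hdV hdV0 ι ψ hψ aOf v i j hS6a
  rintro ⟨x, hx, htr⟩
  have h1 := (hS6a x hx).symm.trans htr
  have h2 := lineTransportSection_injective ↥(maximalRealSubfield (F : Type)) (F : Type) (IsCMField.complexConj (F : Type)) 3
    (complexConj_imagUnit (F : Type)) (imagUnit_ne_zero (F : Type)) (imagUnit_mul_self (F : Type)) (realDiagonal (F : Type) dV hdV)
    (realDiagonal_isSymm (F : Type) dV hdV) (Matrix.diagonal dV) (realDiagonal_map (F : Type) dV hdV).symm (aOf j) v _ _ _ _ h1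
  have h3 : localMu (F : Type) (toHeckeCharacter (F : Type) (ψ i)) v = localMu (F : Type) (toHeckeCharacter (F : Type) (ψ j)) v :=
    localMu_eq_of_congrW_undoubledSplittings_s_eq_three (F : Type) e₁ dV hdV hdV0 _ _ _ _ _ _ _
      (toHeckeCharacter (F : Type) (ψ i)) (toHeckeCharacter (F : Type) (ψ j)) _ _ v h2
  exact h3.symm

set_option maxHeartbeats 1600000 in
/-- **The SPLIT-place form** (binder shape of the registered residual `KudlaTransportedSectionEqSplit` of `Cruxes/HD3/Lines/a4_liuD3.lean`
v3 with the S6a identity inserted as a hypothesis after `i j`): at a place `v` of `F⁺` split in `F`, S6a for member `i` ⇒ `hK i j`.  The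
split twin of `kudla_nonsplit_of_lineRigidity`; both are instances of the place-free `kudla_of_lineRigidity`.
[cite: Kudla1994, §3 Thm. 3.1] [cite: Liu2021, App. D Lemma D.1 (3), proof l. 5249–5254] -/
theorem kudla_split_of_lineRigidity :
    ∀ (F : HodgeCM.CMField) (dV : Fin 3 → (F : Type))
      (hdV : ∀ i, IsCMField.complexConj (F : Type) (dV i) = dV i) (hdV0 : ∀ i, dV i ≠ 0) {ι : Type}
      (ψ : ι → (Literature.NumberTheory.Automorphic.IdeleClassGroup (F : Type) →ₜ* Circle))
      (hψ : ∀ t, IdeleClassGroup.IsConjugateSymplectic (F : Type) (ψ t))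
      (aOf : ι → (↥(maximalRealSubfield (F : Type)))ˣ)
      (v : IsDedekindDomain.HeightOneSpectrum (𝓞 ↥(maximalRealSubfield (F : Type)))),
      ¬ IsField (UnitaryGroup.LocalRing (F : Type) v) →
      ∀ i j : ι,
        (∀ (x : (UnitaryGroup.LocalRing (F : Type) v)ˣ) (hx : algebraMap (F : Type) (UnitaryGroup.LocalRing (F : Type) v) (algebraMap ↥(maximalRealSubfield (F : Type)) (F : Type) (↑(aOf j)⁻¹ : ↥(maximalRealSubfield (F : Type))) * imagUnit (F : Type)) =
            (x : (UnitaryGroup.LocalRing (F : Type) v)) * UnitaryGroup.conjLocal (F : Type) (IsCMField.complexConj (F : Type)) v x * algebraMap (F : Type) (UnitaryGroup.LocalRing (F : Type) v) (algebraMap ↥(maximalRealSubfield (F : Type)) (F : Type) (↑(aOf i)⁻¹ : ↥(maximalRealSubfield (F : Type))) * imagUnit (F : Type))),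
          lineTransportSplitting (F : Type) v (IsCMField.complexConj (F : Type)) 3 (conj_lineDelta (complexConj_imagUnit (F : Type)) (aOf i)) (lineDelta_ne_zero (imagUnit_ne_zero (F : Type)) (aOf i))
            (lineDelta_mul_self (imagUnit_mul_self (F : Type)) (aOf i)) (conj_lineDelta (complexConj_imagUnit (F : Type)) (aOf j)) (lineDelta_ne_zero (imagUnit_ne_zero (F : Type)) (aOf j))
            (lineDelta_mul_self (imagUnit_mul_self (F : Type)) (aOf j)) x (realDiagonal (F : Type) dV hdV) (realDiagonal_isSymm (F : Type) dV hdV) (isUnit_det_realDiagonal (F : Type) dV hdV hdV0) hx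
            (lineTransportSection ↥(maximalRealSubfield (F : Type)) (F : Type) (IsCMField.complexConj (F : Type)) 3 (complexConj_imagUnit (F : Type)) (imagUnit_ne_zero (F : Type)) (imagUnit_mul_self (F : Type)) (realDiagonal (F : Type) dV hdV) (realDiagonal_isSymm (F : Type) dV hdV) (Matrix.diagonal dV) (realDiagonal_map (F : Type) dV hdV).symm (aOf i) v ((OmegaChiSplitting.chiLocalSplittingsD ⟨HodgeCM.CMField.K F⟩ e₁ dV hdV hdV0 (toHeckeCharacter (F : Type) (ψ i)) ((isOscillatorChar_toHeckeCharacter_iff (ψ i)).mpr (hψ i)) (aOf i)).s v) ((OmegaChiSplitting.chiLocalSplittingsD ⟨HodgeCM.CMField.K F⟩ e₁ dV hdV hdV0 (toHeckeCharacter (F : Type) (ψ i)) ((isOscillatorChar_toHeckeCharacter_iff (ψ i)).mpr (hψ i)) (aOf i)).proj_s v)) =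
          (lineTransportSection ↥(maximalRealSubfield (F : Type)) (F : Type) (IsCMField.complexConj (F : Type)) 3 (complexConj_imagUnit (F : Type)) (imagUnit_ne_zero (F : Type)) (imagUnit_mul_self (F : Type)) (realDiagonal (F : Type) dV hdV) (realDiagonal_isSymm (F : Type) dV hdV) (Matrix.diagonal dV) (realDiagonal_map (F : Type) dV hdV).symm (aOf j) v ((OmegaChiSplitting.chiLocalSplittingsD ⟨HodgeCM.CMField.K F⟩ e₁ dV hdV hdV0 (toHeckeCharacter (F : Type) (ψ i)) ((isOscillatorChar_toHeckeCharacter_iff (ψ i)).mpr (hψ i)) (aOf j)).s v) ((OmegaChiSplitting.chiLocalSplittingsD ⟨HodgeCM.CMField.K F⟩ e₁ dV hdV hdV0 (toHeckeCharacter (F : Type) (ψ i)) ((isOscillatorChar_toHeckeCharacter_iff (ψ i)).mpr (hψ i)) (aOf j)).proj_s v))) →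
        (∃ (x : (UnitaryGroup.LocalRing (F : Type) v)ˣ) (hx : algebraMap (F : Type) (UnitaryGroup.LocalRing (F : Type) v) (algebraMap ↥(maximalRealSubfield (F : Type)) (F : Type) (↑(aOf j)⁻¹ : ↥(maximalRealSubfield (F : Type))) * imagUnit (F : Type)) =
            (x : (UnitaryGroup.LocalRing (F : Type) v)) * UnitaryGroup.conjLocal (F : Type) (IsCMField.complexConj (F : Type)) v x * algebraMap (F : Type) (UnitaryGroup.LocalRing (F : Type) v) (algebraMap ↥(maximalRealSubfield (F : Type)) (F : Type) (↑(aOf i)⁻¹ : ↥(maximalRealSubfield (F : Type))) * imagUnit (F : Type))),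
          lineTransportSplitting (F : Type) v (IsCMField.complexConj (F : Type)) 3 (conj_lineDelta (complexConj_imagUnit (F : Type)) (aOf i)) (lineDelta_ne_zero (imagUnit_ne_zero (F : Type)) (aOf i))
            (lineDelta_mul_self (imagUnit_mul_self (F : Type)) (aOf i)) (conj_lineDelta (complexConj_imagUnit (F : Type)) (aOf j)) (lineDelta_ne_zero (imagUnit_ne_zero (F : Type)) (aOf j))
            (lineDelta_mul_self (imagUnit_mul_self (F : Type)) (aOf j)) x (realDiagonal (F : Type) dV hdV) (realDiagonal_isSymm (F : Type) dV hdV) (isUnit_det_realDiagonal (F : Type) dV hdV hdV0) hx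
            (lineTransportSection ↥(maximalRealSubfield (F : Type)) (F : Type) (IsCMField.complexConj (F : Type)) 3 (complexConj_imagUnit (F : Type)) (imagUnit_ne_zero (F : Type)) (imagUnit_mul_self (F : Type)) (realDiagonal (F : Type) dV hdV) (realDiagonal_isSymm (F : Type) dV hdV) (Matrix.diagonal dV) (realDiagonal_map (F : Type) dV hdV).symm (aOf i) v ((OmegaChiSplitting.chiLocalSplittingsD ⟨HodgeCM.CMField.K F⟩ e₁ dV hdV hdV0 (toHeckeCharacter (F : Type) (ψ i)) ((isOscillatorChar_toHeckeCharacter_iff (ψ i)).mpr (hψ i)) (aOf i)).s v) ((OmegaChiSplitting.chiLocalSplittingsD ⟨HodgeCM.CMField.K F⟩ e₁ dV hdV hdV0 (toHeckeCharacter (F : Type) (ψ i)) ((isOscillatorChar_toHeckeCharacter_iff (ψ i)).mpr (hψ i)) (aOf i)).proj_s v)) =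
          (lineTransportSection ↥(maximalRealSubfield (F : Type)) (F : Type) (IsCMField.complexConj (F : Type)) 3 (complexConj_imagUnit (F : Type)) (imagUnit_ne_zero (F : Type)) (imagUnit_mul_self (F : Type)) (realDiagonal (F : Type) dV hdV) (realDiagonal_isSymm (F : Type) dV hdV) (Matrix.diagonal dV) (realDiagonal_map (F : Type) dV hdV).symm (aOf j) v ((OmegaChiSplitting.chiLocalSplittingsD ⟨HodgeCM.CMField.K F⟩ e₁ dV hdV hdV0 (toHeckeCharacter (F : Type) (ψ j)) ((isOscillatorChar_toHeckeCharacter_iff (ψ j)).mpr (hψ j)) (aOf j)).s v) ((OmegaChiSplitting.chiLocalSplittingsD ⟨HodgeCM.CMField.K F⟩ e₁ dV hdV hdV0 (toHeckeCharacter (F : Type) (ψ j)) ((isOscillatorChar_toHeckeCharacter_iff (ψ j)).mpr (hψ j)) (aOf j)).proj_s v))) →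
        localMu (F : Type) (toHeckeCharacter (F : Type) (ψ j)) v = localMu (F : Type) (toHeckeCharacter (F : Type) (ψ i)) v := by
  intro F dV hdV hdV0 ι ψ hψ aOf v _ i j hS6a
  exact kudla_of_lineRigidity F dV hdV hdV0 ψ hψ aOf v i j hS6a

end Summit.HodgeConjecture.CorCM.HypD3

end
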